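import Literature.AlgebraicGeometry.Frobenioids.ArchimedeanStandardType
import Literature.AlgebraicGeometry.Frobenioids.PadicKummerSettingProofs
import Literature.AlgebraicGeometry.Frobenioids.ModelFrobenioidTypeBridge
import Literature.AlgebraicGeometry.Frobenioids.DegreeModelFrobenioid
import HarnessLib

/-!
# Frobenioids II, Thm. 3.6 (i) (characteristic splitting) and Thm. 2.4 (i): two FACT-LIST schema rows —
# the universal closures of `ArchFrd.Thm36i_charSplitting` and `PadicKummer.Thm24i` DECIDED in kernel

Mochizuki, *The geometry of Frobenioids II: poly-Frobenioids*, Kyushu J. Math. **62** (2008) 401–460: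
Theorem 3.6 (i) p. 36 ("the canonical decomposition of Definition 3.1, (ii), determines a characteristic
splitting [cf. [Mzk5], Definition 2.3] on `C^Λ`") [cite: MochizukiFrdII2008, Thm 3.6 (i) p.36]; Theorem 2.4 (i)
pp. 19–20 ("`Φ₁` is fieldwise saturated if and only if `Φ₂` is. Moreover, `p₁ = p₂`; …")
[cite: MochizukiFrdII2008, Thm 2.4 (i) p.19].  (v2, DOC-ONLY: the Thm 3.6 (i) quotation restores print's bracket
«[cf. [Mzk5], Definition 2.3]» — referee lane C finding C30-F1; declarations byte-identical to v1 p504841.)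

PROOF-ONLY companion (cell abc-iut, block F, seat abc-iut-f-027 gen 16) of `ArchimedeanStandardType.lean`
(abc-iut-L1-t12) and `PadicKummerSetting.lean` (abc-iut-L1-t7), answering abc-iut-F-lit's LABEL-CHECK list
`plan/LF-REFUTED-WITHOUT-REFUTER.tsv` (2026-08-27T05:19Z) for the rows **F-0701** `ArchFrd.Thm36i_charSplitting`
and **F-1200** `PadicKummer.Thm24i` (label «universal-closure REFUTED / schema», no kernel refuter of record).
Both declarations are predicates over FREE slots standing for data that print ties to the Frobenioids:

* `Thm36i_charSplitting F radial := ∃ τ : CharacteristicSplitting F, ∀ A isotropic, ∀ t, t ∈ τ(A) ↔ radial A t`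
  — SCHEMA in the structure functor `F` AND in the predicate `radial` (standing for the radial endomorphisms, in
  print the factor `ord(K^×) ≅ ℝ_{>0}` of the canonical decomposition); admissible AT NAMED INSTANCES ONLY (plan R5).  With the junk predicate `radial := ⊥` no submonoid
  `τ(A) ∋ 1` can match it at an isotropic object; witness carrier: the GENUINE Frobenioid `DegreeModel.F` (the
  model Frobenioid of `(pt, ℕ, 0, 0)`, all objects isotropic).  Refuters: `DegreeModel.not_thm36i_charSplitting_bot`,
  `ArchFrd.not_forall_thm36i_charSplitting`.  Instance forms PROVED at the archimedean Frobenioids of Ex. 3.3 with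
  THE radial predicate: `ArchFrd.thm36i_charSplitting_generic_C`, `ArchFrd.thm36i_charSplitting_rlf` (p449961).
* `Thm24i X₁ X₂ N p₁ p₂ fs₁ fs₂ T ι₁ ι₂ := (fs₁ ↔ fs₂) ∧ p₁ = p₂ ∧ …` — SCHEMA in the residue characteristics
  `p₁ p₂ : ℕ`, the propositions `fsᵢ` ("`Φᵢ` fieldwise saturated"), the comparison data `T` and the duality
  isomorphisms `ιᵢ` (in print all determined by the two `p`-adic Frobenioids and `Ψ`).  With the junk numerals
  `p₁ := 0`, `p₂ := 1` the second conjunct is `0 = 1`; witness carrier: the degenerate Definition-2.2 context with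
  all groups trivial (the one place where a `Kummer.DualityIso` — local Tate duality, carried as DATA in the tree —
  is available hypothesis-free: both sides of it are the zero group), identity comparison data
  `(Iso.refl X).thm24Data N`.  Refuter: `PadicKummer.not_forall_thm24i` (with the trivial duality isomorphism
  `PadicKummer.exists_dualityIso_trivialContext`).  Instance forms PROVED: `Def22Context.Iso.thm24i_refl`
  (p446998; every context, `Ψ = 𝟭`), `Def22Context.Iso.thm24i_of_inputs`, and the [EtTh] hull-context family
  (p464761).

HONEST FRAMING.  Bookkeeping about the typing only: a predicate on free slots has instances on both sides; the
printed sentences are the instances at THE data, PROVED in the tree as cited.  Refuted-as-typed ≠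
refuted-in-print; no `def`, no `instance`, no new named fact; no statement of [FrdII] is strengthened or denied;
nothing here bears on [IUTchIII] Cor. 3.12; no side taken.
-/

noncomputable section

namespace Literature.AlgebraicGeometry.Frobenioids

open CategoryTheory Opposite

/-! ### F-0701: `ArchFrd.Thm36i_charSplitting` -/

namespace DegreeModel

/-- **F-0701 at the junk radial predicate `⊥` FAILS over the degree model**: a characteristic splitting `τ`
([FrdI] Def. 2.3) assigns to the isotropic object `ι 0` a submonoid `τ(ι 0) ∋ 1`, so "`t ∈ τ(A) ↔ False`" is
impossible.  (All objects of the model Frobenioid of `(pt, ℕ, 0, 0)` are isotropic, `B = 0` being group-like.)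
[cite: MochizukiFrdII2008, Thm 3.6 (i) p.36] -/
theorem not_thm36i_charSplitting_bot : ¬ ArchFrd.Thm36i_charSplitting F (fun _ _ => False) := by
  rintro ⟨τ, hτ⟩
  have hiso : PreFrobenioid.IsOfIsotropicType F := ModelFrobenioid.isOfIsotropicType objectwise_isGroupLike_B
  exact (hτ (ι 0) (hiso (ι 0)) 1).mp (Submonoid.one_mem _)

end DegreeModel

namespace ArchFrd

/-- **F-0701 (`Thm36i_charSplitting`): the universal closure over the typed binders (universe `0`) is FALSE**
— witness `F :=` the degree model, `radial := ⊥` (`DegreeModel.not_thm36i_charSplitting_bot`).  The printed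
clause of Thm. 3.6 (i) is the instance at the archimedean Frobenioid `C^Λ` of Ex. 3.3 with THE radial predicate,
PROVED: `thm36i_charSplitting_generic_C`, `thm36i_charSplitting_rlf`. [cite: MochizukiFrdII2008, Thm 3.6 (i) p.36] -/
theorem not_forall_thm36i_charSplitting :
    ¬ ∀ (D : Type) [Category.{0} D] (Φ : Dᵒᵖ ⥤ CommMonCat.{0}) (X : Type) [Category.{0} X]
        (F : X ⥤ ElemFrobenioid Φ) (radial : ∀ A : X, (A ⟶ A) → Prop), Thm36i_charSplitting F radial :=
  fun h => DegreeModel.not_thm36i_charSplitting_bot (h _ _ _ DegreeModel.F _)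

end ArchFrd

/-! ### F-1200: `PadicKummer.Thm24i` -/

namespace PadicKummer

open groupCohomology

/-- **A Definition-2.2 context carrying a duality isomorphism hypothesis-free**: for the degenerate context with
`Aut_C(A) = Aut_E(A_E) = G = H = 1` and `O^□(A) = 1`, and any level `N`, both `H¹(H_A, μ_N(A))` and
`H_A^ab ⊗ F_N(A)` are zero groups, so a `Kummer.DualityIso` (in the tree a DATUM — local Tate duality,
[NSW] 7.2.6, is not constructed) exists: the zero map.  Also recorded: comparison data `Thm24Data X X N` exist
(the identity data `(Iso.refl X).thm24Data N`). [cite: MochizukiFrdII2008, Def 2.2 p.18] -/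
theorem exists_dualityIso_trivialContext (N : ℕ) :
    ∃ X : Def22Context, Nonempty (Kummer.DualityIso N X.O X.HA X.qHA) ∧ Nonempty (Thm24Data X X N) := by
  let X : Def22Context :=
    { AutC := PUnit.{1}
      O := PUnit.{1}
      AutE := PUnit.{1}
      res := MonoidHom.id _
      res_smul := fun _ _ => rfl
      G := PUnit.{1}
      H := ⊤
      isOpen_H := isOpen_discrete _
      isGalois := False
      outer := MonoidHom.id _
      outer_surjective := fun hf => hf.elim
      isOpen_ker_outer := isOpen_discrete _ }
  haveI hO : Subsingleton X.O := inferInstanceAs (Subsingleton PUnit)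
  haveI hE : Subsingleton X.AutE := inferInstanceAs (Subsingleton PUnit)
  -- `μ_N(A) ⊆ O^× = 1`
  have hMu : Subsingleton (Kummer.Mu N X.O) := ⟨fun a b => Subtype.ext (Subsingleton.elim _ _)⟩
  -- `H¹(H_A, μ_N(A)) = 0`: every `1`-cocycle with values in the one-element module vanishes
  let A := Rep.ofMulDistribMulAction X.HA (Kummer.Mu N X.O)
  have hV : ∀ a b : A.V, a = b := fun a b => hMu.elim a b
  haveI hZ : Subsingleton (cocycles₁ A) := ⟨fun x y => Subtype.ext (funext fun g => hV _ _)⟩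
  have hH1 : ∀ a b : H1 A, a = b := fun a b => by
    induction a using H1_induction_on with
    | h x =>
      induction b using H1_induction_on with
      | h y => rw [Subsingleton.elim x y]
  -- `H_A^ab ⊗ F_N(A) = 0`: `H_A ⊆ Aut_E(A_E) = 1`
  haveI hHA : Unique X.HA := ⟨⟨1⟩, fun k => Subtype.ext (Subsingleton.elim _ _)⟩
  have hab : ∀ a : Additive (Abelianization X.HA), a = 0 := fun a =>
    Subsingleton.elim (α := Abelianization X.HA) _ _
  have hT : ∀ t : Kummer.RecTarget N X.O X.HA X.qHA, t = 0 := fun t => by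
    induction t using TensorProduct.induction_on with
    | zero => rfl
    | tmul a f => rw [hab a, TensorProduct.zero_tmul]
    | add x y hx hy => rw [hx, hy, add_zero]
  -- the zero map is an isomorphism between zero groups
  let e : H1 A ≃+ Kummer.RecTarget N X.O X.HA X.qHA :=
    AddEquiv.ofBijective (0 : H1 A →+ Kummer.RecTarget N X.O X.HA X.qHA)
      ⟨fun a b _ => hH1 a b, fun t => ⟨0, by rw [hT t, map_zero]⟩⟩
  exact ⟨X, ⟨⟨e⟩⟩, ⟨(Def22Context.Iso.refl X).thm24Data N⟩⟩

/-- **F-1200 (`Thm24i`): the universal closure over the typed binders is FALSE.**  The residue characteristics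
`p₁ p₂ : ℕ` (and the propositions "`Φᵢ` fieldwise saturated", the comparison data, the duality isomorphisms)
are FREE slots of the typed predicate, whereas print's "`p₁ = p₂`" is about the primes OF the two `p`-adic
Frobenioids; at the junk numerals `p₁ := 0`, `p₂ := 1` the second conjunct reads `0 = 1` — tested on the
degenerate context of `exists_dualityIso_trivialContext` (both sides of the duality isomorphism zero, identity
comparison data).  The printed Thm. 2.4 (i) is the instance at the data INDUCED by `Ψ`; PROVED forms:
`Def22Context.Iso.thm24i_refl` (every context, `Ψ = 𝟭`, `p₁ = p₂`, `fs₁ = fs₂`, `ι₁ = ι₂`),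
`Def22Context.Iso.thm24i_of_inputs`. [cite: MochizukiFrdII2008, Thm 2.4 (i) p.19] -/
theorem not_forall_thm24i :
    ¬ ∀ (X₁ X₂ : Def22Context) (N : ℕ) (p₁ p₂ : ℕ) (fs₁ fs₂ : Prop) (T : Thm24Data X₁ X₂ N)
        (ι₁ : Kummer.DualityIso N X₁.O X₁.HA X₁.qHA) (ι₂ : Kummer.DualityIso N X₂.O X₂.HA X₂.qHA),
        Thm24i X₁ X₂ N p₁ p₂ fs₁ fs₂ T ι₁ ι₂ := by
  intro h
  obtain ⟨X, ⟨ι⟩, ⟨T⟩⟩ := exists_dualityIso_trivialContext 1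
  exact absurd (h X X 1 0 1 True True T ι ι).2.1 zero_ne_one

end PadicKummer

end Literature.AlgebraicGeometry.Frobenioids

end
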